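import Summits.NavierStokesRegularity.OSWSelfSimilar.SheetRSpectrumWindingAssembly
import Summits.NavierStokesRegularity.OSWSelfSimilar.SheetRSpectrumOddAssembly
import HarnessLib

/-!
# Sheet-ℝ spectral certificate (Z3-SR-SPEC, S2): the EXIT INTERFACE for the renewal / Laplace route —
# `E ≠ 0` on `{Re σ > −3/100} ∖ {1}`, `E(1) = 0`, `E′(1) ≠ 0`

HONEST FRAMING (cell ns-blowup GROUP B «PROFILE SEARCH»; PROFILE-SPEC v1.3 case Z3-SR-SPEC; 1-D MODEL (viscous gCLM/OSW sheet on `ℝ`);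
computer-assisted; not Euler/NS; «violates: none — MODEL»). Nothing here is a statement about Navier–Stokes; no enclosure is proved here.
WHAT IT DOES (seat ns-blowup-profile-cert-2 g8; composition only): the (P10)/renewal route (cert-5's memo P9-P10-RENEWAL-DESIGN, brick (R-c)
«half-line Paley–Wiener with ONE simple pole») consumes the Evans function through exactly three scalar facts — `E(σ) ≠ 0` for `Re σ > −β₀`,
`σ ≠ 1`; `E(1) = 0`; `E′(1) ≠ 0`. This file states them as consequences of the S2 certificate hypotheses (`RectLabelCertificate E` + the far-field
exclusion `hfar`, both THEOREMS from implementation 2's point records by `SheetRSpectrumPointCertificate` / `…PointAssembly`) and of `E(1) = 0`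
((P6)), with `β₀ = 3/100`:
* §1 abstract (`SheetRSpectrumWindingAssembly.evans J ℓ f θ`, `J` a pseudo-resolvent on an open `U ⊇ K`): `evans_ne_zero_of_ne_one_halfPlane`
  (open rectangle by the certificate via `evans_ne_zero_of_ne_one` + `halfDisc_subset_rect`, outside by `hfar`), `deriv_evans_one_ne_zero`
  (`analyticOrderAt E 1 = 1` from `analyticOrderAt_evans_one` + `Literature.Analysis.OperatorTheory.deriv_ne_zero_of_analyticOrderAt_eq_one`);
* §2 the sheet's odd class (`evansOdd hL K h ℓ f θ`, any Gårding datum with `3/100 < m`): `evansOdd_ne_zero_of_ne_one_halfPlane`,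
  `evansOdd_one_eq_zero_of_weakEigen` ((P6) in selfsim's weak language ⇒ `E(1) = 0`), `deriv_evansOdd_one_ne_zero`.
WHAT THIS IS NOT: not NS; no number of record moves.
-/

noncomputable section

namespace Summit.NavierStokesRegularity.OSWSelfSimilar
namespace SheetRSpectrumEvansHalfPlane

open Literature.Analysis.OperatorTheory Literature.Analysis.Complex SheetRSpectrumWindingLists SheetRSpectrumWindingAssembly Complex Set

/-! ### §1 Abstract -/
section Abstract

variable {X : Type*} [NormedAddCommGroup X] [NormedSpace ℂ X] [CompleteSpace X]
variable {U : Set ℂ} {J : ℂ → X →L[ℂ] X}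

/-- **`E ≠ 0` on the open half-plane `Re σ > −3/100` minus `{1}`**: inside the disc `‖σ‖ ≤ 1141/100` by the rectangle certificate, outside by the
far-field exclusion. [folklore] -/
theorem evans_ne_zero_of_ne_one_halfPlane (h : IsPseudoResolvent U J) (hU : IsOpen U) (hKU : (Icc ra rb ×ℂ Icc rc rd) ⊆ U)
    (ℓ : X →L[ℂ] ℂ) (f : X) (θ : ℂ) (hcert : RectLabelCertificate (evans J ℓ f θ)) (h1 : evans J ℓ f θ 1 = 0)
    (hfar : ∀ σ : ℂ, ra < σ.re → (1141 : ℝ) / 100 < ‖σ‖ → evans J ℓ f θ σ ≠ 0)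
    {σ : ℂ} (hσ : ra < σ.re) (hne : σ ≠ 1) : evans J ℓ f θ σ ≠ 0 := by
  by_cases hn : ‖σ‖ ≤ (1141 : ℝ) / 100
  · exact evans_ne_zero_of_ne_one h hU hKU ℓ f θ hcert h1 (halfDisc_subset_rect hσ hn) hne
  · exact hfar σ hσ (not_le.1 hn)

/-- **`E′(1) ≠ 0`**: the zero at `σ = 1` is simple (`analyticOrderAt E 1 = 1`). [folklore] -/
theorem deriv_evans_one_ne_zero (h : IsPseudoResolvent U J) (hU : IsOpen U) (hKU : (Icc ra rb ×ℂ Icc rc rd) ⊆ U)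
    (ℓ : X →L[ℂ] ℂ) (f : X) (θ : ℂ) (hcert : RectLabelCertificate (evans J ℓ f θ)) (h1 : evans J ℓ f θ 1 = 0) :
    deriv (evans J ℓ f θ) 1 ≠ 0 :=
  deriv_ne_zero_of_analyticOrderAt_eq_one
    (analyticOnNhd_evans_rect h hU hKU ℓ f θ 1 ⟨Ioo_subset_Icc_self one_mem_rect.1, Ioo_subset_Icc_self one_mem_rect.2⟩) h1
    (analyticOrderAt_evans_one h hU hKU ℓ f θ hcert h1)

end Abstract

/-! ### §2 The sheet's odd class -/
section Sheet

open SheetRResolventOddClass SheetROddClass SheetRComplexPivot SheetRPerturbedPair SheetRPerturbedResolventC SheetREnergySpace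
  SheetRResolventIdentity SheetREvansOdd

variable {L D₀ D₁ V₀ c m : ℝ} {d V : ℝ → ℝ}

/-- `evansOdd` is the abstract `evans` of the odd-class resolvent (definitional). [folklore] -/
theorem evansOdd_eq_evans (hL : 0 < L) (K : Esp L hL →L[ℝ] W L) (h : GardingDataKC L hL d V K D₀ D₁ V₀ c m)
    (ℓ : Wcodd L →L[ℂ] ℂ) (f : Wcodd L) (θ : ℂ) : evansOdd hL K h ℓ f θ = evans (resolventOdd hL K h) ℓ f θ := by
  funext σ; rfl

/-- **(P6) ⇒ `E(1) = 0`**: a non-trivial weak eigenvector at `σ = 1` (selfsim's `IsWeakEigen`) makes the Evans function vanish at `1`. [folklore] -/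
theorem evansOdd_one_eq_zero_of_weakEigen (hL : 0 < L) (K : Esp L hL →L[ℝ] W L) (h : GardingDataKC L hL d V K D₀ D₁ V₀ c m)
    (hm : (3 : ℝ) / 100 < m) (ℓ : Wcodd L →L[ℂ] ℂ) (f : Wcodd L) (θ : ℂ) {v : Wcodd L} (hv0 : v ≠ 0)
    (hv : IsWeakEigen hL K d V ℓ f θ 1 v) : evansOdd hL K h ℓ f θ 1 = 0 :=
  (exists_weakEigen_iff_evansOdd_eq_zero hL K h ℓ f θ (σ := 1) (by rw [Complex.one_re]; linarith)).1 ⟨v, hv0, hv⟩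

/-- **`E ≠ 0` on `{Re σ > −3/100} ∖ {1}` for the sheet**, from the certificate, the far-field exclusion and `E(1) = 0`. [folklore] -/
theorem evansOdd_ne_zero_of_ne_one_halfPlane (hL : 0 < L) (K : Esp L hL →L[ℝ] W L) (h : GardingDataKC L hL d V K D₀ D₁ V₀ c m)
    (hm : (3 : ℝ) / 100 < m) (ℓ : Wcodd L →L[ℂ] ℂ) (f : Wcodd L) (θ : ℂ)
    (hcert : RectLabelCertificate (evansOdd hL K h ℓ f θ)) (h1 : evansOdd hL K h ℓ f θ 1 = 0)
    (hfar : ∀ σ : ℂ, ra < σ.re → (1141 : ℝ) / 100 < ‖σ‖ → evansOdd hL K h ℓ f θ σ ≠ 0)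
    {σ : ℂ} (hσ : ra < σ.re) (hne : σ ≠ 1) : evansOdd hL K h ℓ f θ σ ≠ 0 := by
  haveI : CompleteSpace (Wcodd L) := completeSpace_Wcodd L
  rw [evansOdd_eq_evans] at hcert h1 hfar ⊢
  exact evans_ne_zero_of_ne_one_halfPlane (isPseudoResolvent_resolventOdd hL K h) (isOpen_halfPlane m) (rect_subset_halfPlane hm)
    ℓ f θ hcert h1 hfar hσ hne

/-- **`E′(1) ≠ 0` for the sheet.** [folklore] -/
theorem deriv_evansOdd_one_ne_zero (hL : 0 < L) (K : Esp L hL →L[ℝ] W L) (h : GardingDataKC L hL d V K D₀ D₁ V₀ c m)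
    (hm : (3 : ℝ) / 100 < m) (ℓ : Wcodd L →L[ℂ] ℂ) (f : Wcodd L) (θ : ℂ)
    (hcert : RectLabelCertificate (evansOdd hL K h ℓ f θ)) (h1 : evansOdd hL K h ℓ f θ 1 = 0) :
    deriv (evansOdd hL K h ℓ f θ) 1 ≠ 0 := by
  haveI : CompleteSpace (Wcodd L) := completeSpace_Wcodd L
  rw [evansOdd_eq_evans] at hcert h1 ⊢
  exact deriv_evans_one_ne_zero (isPseudoResolvent_resolventOdd hL K h) (isOpen_halfPlane m) (rect_subset_halfPlane hm) ℓ f θ hcert h1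

end Sheet

end SheetRSpectrumEvansHalfPlane
end Summit.NavierStokesRegularity.OSWSelfSimilar

end
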